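import Summits.QuantumFields.YangMills.Theorems.UnitScaleTiltProp7LineAvgSmoothNormal
import HarnessLib

/-!
# Route `UnitScaleTilt`, crux K1 child «MinimiserStabilityRegPr» (stmt-QuantumFields-19200), registered stub `stub_prop7From14` (skeleton birth_v6
# 636b1fa3b005; leaf V3 «Prop 7 from a background (14)») — sub-lemma V3-C″ (the GRADIENT half of (46)), part 2/3: THE FOUR BOUNDS OF THE
# TRANSVERSALLY MODULATED TENT FIELD — sup, `ℓ²`, and the GRADIENT in sup and in `ℓ²`

Cell `ym3-torus` ∕ fleet seat `ym-ust-19200-p1` (gen 4).  Second file of the smooth-right-inverse series (part 1: `UnitScaleTiltProp7LineAvgSmoothNormal` —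
the modulated tent field `Z(b) = (L^{kd}L^k)⁻¹((s_b+1)W(ȳ_b) + (L^k−1−s_b)W(ȳ_b − e_μ))·Π_{ν≠μ}ψ(r_ν(b))` of a coarse bond field `W` and its normal
operator, which is gen 3's axis-tridiagonal `T` for every profile of block mean `1`).  WHY ([Balaban1985Variational] (46) p. 285, second half «|∇HB| ≤
B₀(L^jη)⁻²|B|»): the `ℓ²` uniqueness route of the item corrects a secant `Y` between two fibre points to a tangent vector by `Y ↦ Y − H(M_kY)` (p509106),
and the Dirichlet energy `Σ_p|∂(H(M_kY))(p)|²` of the correction enters the coercivity estimate ([Balaban1984PropagatorsII] Thm 3.11 on the kernel);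
it is affordable only if `H` gains a factor `L^{−k}` under differences — the content of this file for the modulated tent field, given a profile `ψ`
with `0 ≤ ψ ≤ 2`, `|ψ(s+1) − ψ(s)| ≤ 6L^{−k}` inside the block and `ψ(0), ψ(L^k−1) ≤ 6L^{−k}` at its faces (part 3 supplies `ψ(s) = 6(s+1)(L^k−s)∕((L^k+1)(L^k+2))`).

WHAT IS PROVED HERE (sorry-free, no definition; [folklore] lattice bookkeeping).  `n = L^k`, `C₀ = (L^{kd}L^k)⁻¹`.
* §4 `modField_abs_le` (`|Z(b)| ≤ 2^{d−1}(L^{kd})⁻¹max|W|`), `modField_sum_sq_le` (`ΣZ² ≤ 2·4^{d−1}(L^{kd})⁻¹ΣW²`) — gen 3's tent bounds times `Πψ ≤ 2^{d−1}`.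
* §5 the gradient in block coordinates, four cases: axial inside (`modField_shift_axial_in`: tent slope `C₀(W(ȳ) − W(ȳ−e_μ))`), axial across the face
  (`modField_shift_axial_out`: `C₀(W(ȳ+e_μ) − W(ȳ))`), transversal inside (`modField_shift_trans_in`: only the factor `ψ(r_ρ)` moves, by `≤ 6L^{−k}`),
  transversal across the face (`modField_shift_trans_out`: both values carry a face value `≤ 6L^{−k}` of the profile); assembled in
  **`modField_shift_sub_abs_le`**: `|Z(x+e_ρ, μ) − Z(x, μ)| ≤ 6·2^{d−1}·C₀·(|W(ȳ)| + |W(ȳ−e_μ)| + |W(ȳ+e_μ)| + |W(ȳ+e_ρ)| + |W(ȳ+e_ρ−e_μ)|)`.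
* §6 at an arbitrary fine bond: `modField_shift_sub_abs_le_bond`, **`modField_shift_sub_abs_le_of_bound`** (`≤ 30·2^{d−1}·C₀·max|W|` — one order `L^{−k}`
  below the size of `Z`), and **`modField_grad_sum_sq_le`** (`Σ_bΣ_ρ(Z(b+e_ρ) − Z(b))² ≤ 900·d·4^{d−1}·C₀²·L^{kd}·Σ_cW(c)²`, via `sum_five_translates`).

WHAT THIS IS NOT.  Flat background, straight-line main term `M_k` only; not print's `G`-weighted `H`; nothing of Bałaban's is asserted.

References: T. Bałaban, CMP 102 (1985) 277–309 [Balaban1985Variational] ((45)–(47) p.285); CMP 96 (1984) 223–250 [Balaban1984PropagatorsII] (Thms 3.11–3.12).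
-/

noncomputable section

open scoped BigOperators

namespace Summit.QuantumFields.YangMills.Theorems.Prop7LineAvgSmoothRightInverse

open Literature.MathematicalPhysics.QuantumFieldTheory.Balaban1983to89
open Finset LatticeFieldCalculus B1RG242Torus
open B10StarCount (sum_pbond shift_apply_self shift_apply_ne unshift_shift shiftEquiv)
open Summit.QuantumFields.YangMills.Theorems.Prop7FlatCoercivity (iterate_shift_eq_runSite runSite_runSite runSite_apply_self
  runSite_apply_of_ne fibreSite_runSite sum_fibre_eq_sum_offsets sum_shift)
open Summit.QuantumFields.YangMills.Theorems.Prop7LineAvgRightInverse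

variable {P : Params} {k : ℕ}

/-! ## §4 The four bounds of the modulated field -/

section Bounds

variable (h : P.sitesPerDir 0 = P.L ^ k * P.sitesPerDir k)
variable (ψ : ℕ → ℝ) (W : PBond P k → ℝ) (Z : PBond P 0 → ℝ)
  (hZ : ∀ b : PBond P 0, Z b = (((P.L : ℝ) ^ k) ^ P.d * (P.L : ℝ) ^ k)⁻¹ *
    (((((b.src b.dir).val % P.L ^ k : ℕ) : ℝ) + 1) * W ⟨Site.proj k k b.src, b.dir⟩
      + ((P.L ^ k - 1 - (b.src b.dir).val % P.L ^ k : ℕ) : ℝ) * W ⟨(Site.proj k k b.src).unshift b.dir, b.dir⟩)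
    * ∏ ν ∈ univ.erase b.dir, ψ ((b.src ν).val % P.L ^ k))
  (hψ0 : ∀ s : ℕ, s < P.L ^ k → 0 ≤ ψ s) (hψ2 : ∀ s : ℕ, s < P.L ^ k → ψ s ≤ 2)

include hψ0 in
/-- Products of the profile over transversal directions are nonnegative. [folklore] -/
theorem prod_profile_nonneg (S : Finset (Fin P.d)) (r : Fin P.d → Fin (P.L ^ k)) : 0 ≤ ∏ ν ∈ S, ψ (r ν) :=
  Finset.prod_nonneg fun ν _ => hψ0 _ (r ν).isLt

include hψ0 hψ2 in
/-- Products of the profile over at most `d − 1` transversal directions are `≤ 2^{d−1}`. [folklore] -/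
theorem prod_profile_le (S : Finset (Fin P.d)) (hS : S.card ≤ P.d - 1) (r : Fin P.d → Fin (P.L ^ k)) :
    ∏ ν ∈ S, ψ (r ν) ≤ 2 ^ (P.d - 1) := by
  calc ∏ ν ∈ S, ψ (r ν) ≤ ∏ _ν ∈ S, (2 : ℝ) := Finset.prod_le_prod (fun ν _ => hψ0 _ (r ν).isLt) (fun ν _ => hψ2 _ (r ν).isLt)
    _ = 2 ^ S.card := Finset.prod_const 2
    _ ≤ 2 ^ (P.d - 1) := pow_le_pow_right₀ (by norm_num) hS

include hZ hψ0 hψ2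

/-- **SUP BOUND**: `|Z(b)| ≤ 2^{d−1}·(L^k)^{−d}·max|W|` (gen 3's tent bound `(L^k)^{−d}max|W|` times `Πψ ≤ 2^{d−1}`). [folklore] -/
theorem modField_abs_le {B : ℝ} (hW : ∀ c : PBond P k, |W c| ≤ B) (b : PBond P 0) :
    |Z b| ≤ 2 ^ (P.d - 1) * (((P.L : ℝ) ^ k) ^ P.d)⁻¹ * B := by
  classical
  have hA := adjField_abs_le (k := k) W (fun b : PBond P 0 => (((P.L : ℝ) ^ k) ^ P.d * (P.L : ℝ) ^ k)⁻¹ *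
    (((((b.src b.dir).val % P.L ^ k : ℕ) : ℝ) + 1) * W ⟨Site.proj k k b.src, b.dir⟩
      + ((P.L ^ k - 1 - (b.src b.dir).val % P.L ^ k : ℕ) : ℝ) * W ⟨(Site.proj k k b.src).unshift b.dir, b.dir⟩)) (fun _ => rfl) hW b
  have hB : 0 ≤ B := (abs_nonneg _).trans (hW ⟨Site.proj k k b.src, b.dir⟩)
  have hP0 : 0 ≤ ∏ ν ∈ univ.erase b.dir, ψ ((b.src ν).val % P.L ^ k) :=
    Finset.prod_nonneg fun ν _ => hψ0 _ (Nat.mod_lt _ (pow_pos P.L_pos k))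
  have hP2 : ∏ ν ∈ univ.erase b.dir, ψ ((b.src ν).val % P.L ^ k) ≤ 2 ^ (P.d - 1) := by
    calc ∏ ν ∈ univ.erase b.dir, ψ ((b.src ν).val % P.L ^ k) ≤ ∏ _ν ∈ univ.erase b.dir, (2 : ℝ) :=
          Finset.prod_le_prod (fun ν _ => hψ0 _ (Nat.mod_lt _ (pow_pos P.L_pos k))) (fun ν _ => hψ2 _ (Nat.mod_lt _ (pow_pos P.L_pos k)))
      _ = 2 ^ (P.d - 1) := by rw [Finset.prod_const, Finset.card_erase_of_mem (mem_univ _), Finset.card_univ, Fintype.card_fin]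
  rw [hZ, abs_mul, abs_of_nonneg hP0]
  calc _ ≤ ((((P.L : ℝ) ^ k) ^ P.d)⁻¹ * B) * 2 ^ (P.d - 1) := mul_le_mul hA hP2 hP0 (by positivity)
    _ = 2 ^ (P.d - 1) * (((P.L : ℝ) ^ k) ^ P.d)⁻¹ * B := by ring

include h in
/-- **`ℓ²` BOUND**: `Σ_b Z(b)² ≤ 2·4^{d−1}·(L^k)^{−d}·Σ_c W(c)²`. [folklore] -/
theorem modField_sum_sq_le : ∑ b : PBond P 0, (Z b) ^ 2 ≤ 2 * 4 ^ (P.d - 1) * (((P.L : ℝ) ^ k) ^ P.d)⁻¹ * ∑ c : PBond P k, (W c) ^ 2 := by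
  classical
  set A : PBond P 0 → ℝ := fun b : PBond P 0 => (((P.L : ℝ) ^ k) ^ P.d * (P.L : ℝ) ^ k)⁻¹ *
    (((((b.src b.dir).val % P.L ^ k : ℕ) : ℝ) + 1) * W ⟨Site.proj k k b.src, b.dir⟩
      + ((P.L ^ k - 1 - (b.src b.dir).val % P.L ^ k : ℕ) : ℝ) * W ⟨(Site.proj k k b.src).unshift b.dir, b.dir⟩) with hAdef
  have hA2 := adjField_sum_sq_le h W A (fun _ => rfl)
  have hpt : ∀ b : PBond P 0, (Z b) ^ 2 ≤ 4 ^ (P.d - 1) * (A b) ^ 2 := by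
    intro b
    have hP0 : 0 ≤ ∏ ν ∈ univ.erase b.dir, ψ ((b.src ν).val % P.L ^ k) :=
      Finset.prod_nonneg fun ν _ => hψ0 _ (Nat.mod_lt _ (pow_pos P.L_pos k))
    have hP2 : ∏ ν ∈ univ.erase b.dir, ψ ((b.src ν).val % P.L ^ k) ≤ 2 ^ (P.d - 1) := by
      calc ∏ ν ∈ univ.erase b.dir, ψ ((b.src ν).val % P.L ^ k) ≤ ∏ _ν ∈ univ.erase b.dir, (2 : ℝ) :=
            Finset.prod_le_prod (fun ν _ => hψ0 _ (Nat.mod_lt _ (pow_pos P.L_pos k))) (fun ν _ => hψ2 _ (Nat.mod_lt _ (pow_pos P.L_pos k)))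
        _ = 2 ^ (P.d - 1) := by rw [Finset.prod_const, Finset.card_erase_of_mem (mem_univ _), Finset.card_univ, Fintype.card_fin]
    have hZb : Z b = A b * ∏ ν ∈ univ.erase b.dir, ψ ((b.src ν).val % P.L ^ k) := by rw [hZ]
    rw [hZb, mul_pow]
    have hsq : (∏ ν ∈ univ.erase b.dir, ψ ((b.src ν).val % P.L ^ k)) ^ 2 ≤ 4 ^ (P.d - 1) := by
      calc (∏ ν ∈ univ.erase b.dir, ψ ((b.src ν).val % P.L ^ k)) ^ 2 ≤ (2 ^ (P.d - 1) : ℝ) ^ 2 := pow_le_pow_left₀ hP0 hP2 2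
        _ = 4 ^ (P.d - 1) := by rw [← pow_mul, mul_comm, pow_mul]; norm_num
    nlinarith [sq_nonneg (A b)]
  calc ∑ b : PBond P 0, (Z b) ^ 2 ≤ ∑ b : PBond P 0, 4 ^ (P.d - 1) * (A b) ^ 2 := Finset.sum_le_sum fun b _ => hpt b
    _ = 4 ^ (P.d - 1) * ∑ b : PBond P 0, (A b) ^ 2 := by rw [Finset.mul_sum]
    _ ≤ 4 ^ (P.d - 1) * (2 * (((P.L : ℝ) ^ k) ^ P.d)⁻¹ * ∑ c : PBond P k, (W c) ^ 2) := mul_le_mul_of_nonneg_left hA2 (by positivity)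
    _ = 2 * 4 ^ (P.d - 1) * (((P.L : ℝ) ^ k) ^ P.d)⁻¹ * ∑ c : PBond P k, (W c) ^ 2 := by ring

/-! ## §5 The gradient of the modulated field: the four cases and the pointwise bound -/

include h

omit hψ0 hψ2 in
/-- Axial step inside the block: the tent slope `(L^{kd}L^k)⁻¹(W(ȳ) − W(ȳ − e_μ))` times the transversal profile. [folklore] -/
theorem modField_shift_axial_in (y : Site P k) (μ : Fin P.d) (r : Fin P.d → Fin (P.L ^ k)) (hr : (r μ : ℕ) + 1 < P.L ^ k) :
    Z ⟨(Site.fibreSite 0 k y r).shift μ, μ⟩ - Z ⟨Site.fibreSite 0 k y r, μ⟩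
      = (((P.L : ℝ) ^ k) ^ P.d * (P.L : ℝ) ^ k)⁻¹ * (W ⟨y, μ⟩ - W ⟨y.unshift μ, μ⟩) * ∏ ν ∈ univ.erase μ, ψ (r ν) := by
  rw [fibreSite_shift_of_lt y r μ hr, modField_fibreSite h ψ W Z hZ, modField_fibreSite h ψ W Z hZ]
  have hprod : ∏ ν ∈ univ.erase μ, ψ ((Function.update r μ ⟨(r μ : ℕ) + 1, hr⟩) ν) = ∏ ν ∈ univ.erase μ, ψ (r ν) :=
    Finset.prod_congr rfl fun ν hν => by rw [Function.update_of_ne (Finset.ne_of_mem_erase hν)]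
  rw [hprod]
  simp only [Function.update_self, Fin.val_mk]
  have hc1 : ((P.L ^ k - 1 - ((r μ : ℕ) + 1) : ℕ) : ℝ) = ((P.L ^ k - 1 - (r μ : ℕ) : ℕ) : ℝ) - 1 := by
    rw [show P.L ^ k - 1 - (r μ : ℕ) = (P.L ^ k - 1 - ((r μ : ℕ) + 1)) + 1 by omega]; push_cast; ring
  rw [hc1]; push_cast; ring

omit hψ0 hψ2 in
/-- Axial step across the block face: the slope `(L^{kd}L^k)⁻¹(W(ȳ + e_μ) − W(ȳ))` times the transversal profile. [folklore] -/
theorem modField_shift_axial_out (y : Site P k) (μ : Fin P.d) (r : Fin P.d → Fin (P.L ^ k)) (hr : (r μ : ℕ) + 1 = P.L ^ k) :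
    Z ⟨(Site.fibreSite 0 k y r).shift μ, μ⟩ - Z ⟨Site.fibreSite 0 k y r, μ⟩
      = (((P.L : ℝ) ^ k) ^ P.d * (P.L : ℝ) ^ k)⁻¹ * (W ⟨y.shift μ, μ⟩ - W ⟨y, μ⟩) * ∏ ν ∈ univ.erase μ, ψ (r ν) := by
  rw [fibreSite_shift_of_eq h y r μ hr, modField_fibreSite h ψ W Z hZ, modField_fibreSite h ψ W Z hZ, unshift_shift]
  have hprod : ∏ ν ∈ univ.erase μ, ψ ((Function.update r μ ⟨0, pow_pos P.L_pos k⟩) ν) = ∏ ν ∈ univ.erase μ, ψ (r ν) :=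
    Finset.prod_congr rfl fun ν hν => by rw [Function.update_of_ne (Finset.ne_of_mem_erase hν)]
  rw [hprod]
  simp only [Function.update_self, Fin.val_mk]
  have hc1 : ((P.L ^ k - 1 - (r μ : ℕ) : ℕ) : ℝ) = 0 := by rw [show P.L ^ k - 1 - (r μ : ℕ) = 0 by omega]; push_cast; ring
  have hc2 : ((P.L ^ k - 1 - 0 : ℕ) : ℝ) = ((r μ : ℕ) : ℝ) := by rw [show P.L ^ k - 1 - 0 = (r μ : ℕ) by omega]
  rw [hc1, hc2]; push_cast; ring

omit hψ0 hψ2 in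
/-- Transversal step inside the block (`ρ ≠ μ`): only the `ρ`-factor of the profile changes. [folklore] -/
theorem modField_shift_trans_in (y : Site P k) {μ ρ : Fin P.d} (hρ : ρ ≠ μ) (r : Fin P.d → Fin (P.L ^ k)) (hr : (r ρ : ℕ) + 1 < P.L ^ k) :
    Z ⟨(Site.fibreSite 0 k y r).shift ρ, μ⟩ - Z ⟨Site.fibreSite 0 k y r, μ⟩
      = (((P.L : ℝ) ^ k) ^ P.d * (P.L : ℝ) ^ k)⁻¹ *
        ((((r μ : ℕ) : ℝ) + 1) * W ⟨y, μ⟩ + ((P.L ^ k - 1 - (r μ : ℕ) : ℕ) : ℝ) * W ⟨y.unshift μ, μ⟩)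
        * ((ψ ((r ρ : ℕ) + 1) - ψ (r ρ)) * ∏ ν ∈ (univ.erase μ).erase ρ, ψ (r ν)) := by
  have hρmem : ρ ∈ univ.erase μ := Finset.mem_erase.mpr ⟨hρ, mem_univ _⟩
  rw [fibreSite_shift_of_lt y r ρ hr, modField_fibreSite h ψ W Z hZ, modField_fibreSite h ψ W Z hZ,
    Function.update_of_ne hρ.symm, ← Finset.mul_prod_erase _ _ hρmem, ← Finset.mul_prod_erase (univ.erase μ) (fun ν => ψ (r ν)) hρmem]
  have hprod : ∏ ν ∈ (univ.erase μ).erase ρ, ψ ((Function.update r ρ ⟨(r ρ : ℕ) + 1, hr⟩) ν) = ∏ ν ∈ (univ.erase μ).erase ρ, ψ (r ν) :=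
    Finset.prod_congr rfl fun ν hν => by rw [Function.update_of_ne (Finset.ne_of_mem_erase hν)]
  rw [hprod]
  simp only [Function.update_self, Fin.val_mk]
  ring

omit hψ0 hψ2 in
/-- Transversal step across the block face (`ρ ≠ μ`): the two values, each carrying a FACE value of the profile (`ψ(0)`, `ψ(L^k − 1)`). [folklore] -/
theorem modField_shift_trans_out (y : Site P k) {μ ρ : Fin P.d} (hρ : ρ ≠ μ) (r : Fin P.d → Fin (P.L ^ k)) (hr : (r ρ : ℕ) + 1 = P.L ^ k) :
    Z ⟨(Site.fibreSite 0 k y r).shift ρ, μ⟩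
      = (((P.L : ℝ) ^ k) ^ P.d * (P.L : ℝ) ^ k)⁻¹ *
        ((((r μ : ℕ) : ℝ) + 1) * W ⟨y.shift ρ, μ⟩ + ((P.L ^ k - 1 - (r μ : ℕ) : ℕ) : ℝ) * W ⟨(y.shift ρ).unshift μ, μ⟩)
        * (ψ 0 * ∏ ν ∈ (univ.erase μ).erase ρ, ψ (r ν)) ∧
    Z ⟨Site.fibreSite 0 k y r, μ⟩
      = (((P.L : ℝ) ^ k) ^ P.d * (P.L : ℝ) ^ k)⁻¹ *
        ((((r μ : ℕ) : ℝ) + 1) * W ⟨y, μ⟩ + ((P.L ^ k - 1 - (r μ : ℕ) : ℕ) : ℝ) * W ⟨y.unshift μ, μ⟩)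
        * (ψ (P.L ^ k - 1) * ∏ ν ∈ (univ.erase μ).erase ρ, ψ (r ν)) := by
  have hρmem : ρ ∈ univ.erase μ := Finset.mem_erase.mpr ⟨hρ, mem_univ _⟩
  constructor
  · rw [fibreSite_shift_of_eq h y r ρ hr, modField_fibreSite h ψ W Z hZ, Function.update_of_ne hρ.symm, ← Finset.mul_prod_erase _ _ hρmem]
    have hprod : ∏ ν ∈ (univ.erase μ).erase ρ, ψ ((Function.update r ρ ⟨0, pow_pos P.L_pos k⟩) ν) = ∏ ν ∈ (univ.erase μ).erase ρ, ψ (r ν) :=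
      Finset.prod_congr rfl fun ν hν => by rw [Function.update_of_ne (Finset.ne_of_mem_erase hν)]
    rw [hprod]
    simp only [Function.update_self, Fin.val_mk]
  · rw [modField_fibreSite h ψ W Z hZ, ← Finset.mul_prod_erase (univ.erase μ) (fun ν => ψ (r ν)) hρmem,
      show (r ρ : ℕ) = P.L ^ k - 1 by omega]

variable (hψL : ∀ s : ℕ, s + 1 < P.L ^ k → |ψ (s + 1) - ψ s| ≤ 6 * ((P.L : ℝ) ^ k)⁻¹)
  (hψf : ψ 0 ≤ 6 * ((P.L : ℝ) ^ k)⁻¹) (hψl : ψ (P.L ^ k - 1) ≤ 6 * ((P.L : ℝ) ^ k)⁻¹)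
include hψL hψf hψl

/-- **POINTWISE GRADIENT BOUND IN BLOCK COORDINATES**: for every fine bond `⟨x, μ⟩`, `x ∈ B^k(y)`, and every direction `ρ`,
`|Z(x + e_ρ, μ) − Z(x, μ)| ≤ 6·2^{d−1}·(L^{kd}L^k)⁻¹·(|W(y)| + |W(y−e_μ)| + |W(y+e_μ)| + |W(y+e_ρ)| + |W(y+e_ρ−e_μ)|)` (all at direction `μ`):
one order `L^{−k}` below the size `(L^{kd})⁻¹·max|W|` of the field itself — the profile is Lipschitz with constant `6L^{−k}` inside blocks and
`≤ 6L^{−k}` at the transverse faces, the tent has slope `(L^{kd}L^k)⁻¹`. [folklore] -/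
theorem modField_shift_sub_abs_le (y : Site P k) (μ ρ : Fin P.d) (r : Fin P.d → Fin (P.L ^ k)) :
    |Z ⟨(Site.fibreSite 0 k y r).shift ρ, μ⟩ - Z ⟨Site.fibreSite 0 k y r, μ⟩|
      ≤ 6 * 2 ^ (P.d - 1) * (((P.L : ℝ) ^ k) ^ P.d * (P.L : ℝ) ^ k)⁻¹ *
        (|W ⟨y, μ⟩| + |W ⟨y.unshift μ, μ⟩| + |W ⟨y.shift μ, μ⟩| + |W ⟨y.shift ρ, μ⟩| + |W ⟨(y.shift ρ).unshift μ, μ⟩|) := by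
  have hN : (0 : ℝ) < (P.L : ℝ) ^ k := pow_pos (by exact_mod_cast P.L_pos) k
  have hNinv : ((P.L : ℝ) ^ k)⁻¹ * (P.L : ℝ) ^ k = 1 := inv_mul_cancel₀ hN.ne'
  set C₀ : ℝ := (((P.L : ℝ) ^ k) ^ P.d * (P.L : ℝ) ^ k)⁻¹ with hC₀
  have hC0 : 0 ≤ C₀ := by positivity
  -- the tent coefficients
  have ha0 : (0 : ℝ) ≤ ((r μ : ℕ) : ℝ) + 1 := by positivity
  have hb0 : (0 : ℝ) ≤ ((P.L ^ k - 1 - (r μ : ℕ) : ℕ) : ℝ) := by positivity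
  have haN : ((r μ : ℕ) : ℝ) + 1 ≤ (P.L : ℝ) ^ k := by
    have := (r μ).isLt
    have : ((r μ : ℕ) : ℝ) + 1 ≤ ((P.L ^ k : ℕ) : ℝ) := by exact_mod_cast this
    push_cast at this; linarith
  have hbN : ((P.L ^ k - 1 - (r μ : ℕ) : ℕ) : ℝ) ≤ (P.L : ℝ) ^ k := by
    have : ((P.L ^ k - 1 - (r μ : ℕ) : ℕ) : ℝ) ≤ ((P.L ^ k : ℕ) : ℝ) := by exact_mod_cast (by omega)
    push_cast at this; linarith
  have hax : ∀ U V : ℝ, |(((r μ : ℕ) : ℝ) + 1) * U + ((P.L ^ k - 1 - (r μ : ℕ) : ℕ) : ℝ) * V| ≤ (P.L : ℝ) ^ k * (|U| + |V|) := by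
    intro U V
    refine (abs_add_le _ _).trans ?_
    rw [abs_mul, abs_mul, abs_of_nonneg ha0, abs_of_nonneg hb0, mul_add]
    gcongr
  -- the transversal profile
  have hPμ0 : 0 ≤ ∏ ν ∈ univ.erase μ, ψ (r ν) := prod_profile_nonneg ψ hψ0 _ r
  have hPμ : ∏ ν ∈ univ.erase μ, ψ (r ν) ≤ 2 ^ (P.d - 1) :=
    prod_profile_le ψ hψ0 hψ2 _ (by rw [Finset.card_erase_of_mem (mem_univ _), Finset.card_univ, Fintype.card_fin]) r
  have hPρ0 : 0 ≤ ∏ ν ∈ (univ.erase μ).erase ρ, ψ (r ν) := prod_profile_nonneg ψ hψ0 _ r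
  have hPρ : ∏ ν ∈ (univ.erase μ).erase ρ, ψ (r ν) ≤ 2 ^ (P.d - 1) :=
    prod_profile_le ψ hψ0 hψ2 _ ((Finset.card_erase_le).trans
      (by rw [Finset.card_erase_of_mem (mem_univ _), Finset.card_univ, Fintype.card_fin])) r
  -- abbreviations for the five coarse values
  have h1 := abs_nonneg (W ⟨y, μ⟩)
  have h2 := abs_nonneg (W ⟨y.unshift μ, μ⟩)
  have h3 := abs_nonneg (W ⟨y.shift μ, μ⟩)
  have h4 := abs_nonneg (W ⟨y.shift ρ, μ⟩)
  have h5 := abs_nonneg (W ⟨(y.shift ρ).unshift μ, μ⟩)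
  have h2pos : (0 : ℝ) ≤ 2 ^ (P.d - 1) := by positivity
  by_cases hρ : ρ = μ
  · subst hρ
    by_cases hr : (r ρ : ℕ) + 1 < P.L ^ k
    · rw [modField_shift_axial_in h ψ W Z hZ y ρ r hr, abs_mul, abs_mul, abs_of_nonneg hC0, abs_of_nonneg hPμ0]
      have hd : |W ⟨y, ρ⟩ - W ⟨y.unshift ρ, ρ⟩| ≤ |W ⟨y, ρ⟩| + |W ⟨y.unshift ρ, ρ⟩| := abs_sub _ _
      calc C₀ * |W ⟨y, ρ⟩ - W ⟨y.unshift ρ, ρ⟩| * ∏ ν ∈ univ.erase ρ, ψ (r ν)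
          ≤ C₀ * (|W ⟨y, ρ⟩| + |W ⟨y.unshift ρ, ρ⟩|) * 2 ^ (P.d - 1) := by gcongr
        _ ≤ _ := by nlinarith [mul_nonneg hC0 h2pos, mul_nonneg (mul_nonneg hC0 h2pos) h1, mul_nonneg (mul_nonneg hC0 h2pos) h2,
              mul_nonneg (mul_nonneg hC0 h2pos) h3, mul_nonneg (mul_nonneg hC0 h2pos) h4, mul_nonneg (mul_nonneg hC0 h2pos) h5]
    · have hr' : (r ρ : ℕ) + 1 = P.L ^ k := by have := (r ρ).isLt; omega
      rw [modField_shift_axial_out h ψ W Z hZ y ρ r hr', abs_mul, abs_mul, abs_of_nonneg hC0, abs_of_nonneg hPμ0]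
      have hd : |W ⟨y.shift ρ, ρ⟩ - W ⟨y, ρ⟩| ≤ |W ⟨y.shift ρ, ρ⟩| + |W ⟨y, ρ⟩| := abs_sub _ _
      calc C₀ * |W ⟨y.shift ρ, ρ⟩ - W ⟨y, ρ⟩| * ∏ ν ∈ univ.erase ρ, ψ (r ν)
          ≤ C₀ * (|W ⟨y.shift ρ, ρ⟩| + |W ⟨y, ρ⟩|) * 2 ^ (P.d - 1) := by gcongr
        _ ≤ _ := by nlinarith [mul_nonneg hC0 h2pos, mul_nonneg (mul_nonneg hC0 h2pos) h1, mul_nonneg (mul_nonneg hC0 h2pos) h2,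
              mul_nonneg (mul_nonneg hC0 h2pos) h3, mul_nonneg (mul_nonneg hC0 h2pos) h4, mul_nonneg (mul_nonneg hC0 h2pos) h5]
  · by_cases hr : (r ρ : ℕ) + 1 < P.L ^ k
    · rw [modField_shift_trans_in h ψ W Z hZ y hρ r hr, abs_mul, abs_mul, abs_of_nonneg hC0, abs_mul, abs_of_nonneg hPρ0]
      have hA := hax (W ⟨y, μ⟩) (W ⟨y.unshift μ, μ⟩)
      have hψd := hψL (r ρ) hr
      calc C₀ * |(((r μ : ℕ) : ℝ) + 1) * W ⟨y, μ⟩ + ((P.L ^ k - 1 - (r μ : ℕ) : ℕ) : ℝ) * W ⟨y.unshift μ, μ⟩|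
            * (|ψ ((r ρ : ℕ) + 1) - ψ (r ρ)| * ∏ ν ∈ (univ.erase μ).erase ρ, ψ (r ν))
          ≤ C₀ * ((P.L : ℝ) ^ k * (|W ⟨y, μ⟩| + |W ⟨y.unshift μ, μ⟩|)) * ((6 * ((P.L : ℝ) ^ k)⁻¹) * 2 ^ (P.d - 1)) := by
            gcongr
        _ = 6 * 2 ^ (P.d - 1) * C₀ * (|W ⟨y, μ⟩| + |W ⟨y.unshift μ, μ⟩|) * (((P.L : ℝ) ^ k)⁻¹ * (P.L : ℝ) ^ k) := by ring
        _ ≤ _ := by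
            rw [hNinv, mul_one]
            nlinarith [mul_nonneg hC0 h2pos, mul_nonneg (mul_nonneg hC0 h2pos) h3, mul_nonneg (mul_nonneg hC0 h2pos) h4,
              mul_nonneg (mul_nonneg hC0 h2pos) h5]
    · have hr' : (r ρ : ℕ) + 1 = P.L ^ k := by have := (r ρ).isLt; omega
      obtain ⟨e1, e2⟩ := modField_shift_trans_out h ψ W Z hZ y hρ r hr'
      have hψf0 : 0 ≤ ψ 0 := hψ0 0 (pow_pos P.L_pos k)
      have hψl0 : 0 ≤ ψ (P.L ^ k - 1) := hψ0 _ (by have := pow_pos P.L_pos k; omega)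
      have hb1 : |Z ⟨(Site.fibreSite 0 k y r).shift ρ, μ⟩| ≤ 6 * 2 ^ (P.d - 1) * C₀ * (|W ⟨y.shift ρ, μ⟩| + |W ⟨(y.shift ρ).unshift μ, μ⟩|) := by
        rw [e1, abs_mul, abs_mul, abs_of_nonneg hC0, abs_of_nonneg (mul_nonneg hψf0 hPρ0)]
        calc C₀ * |(((r μ : ℕ) : ℝ) + 1) * W ⟨y.shift ρ, μ⟩ + ((P.L ^ k - 1 - (r μ : ℕ) : ℕ) : ℝ) * W ⟨(y.shift ρ).unshift μ, μ⟩|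
              * (ψ 0 * ∏ ν ∈ (univ.erase μ).erase ρ, ψ (r ν))
            ≤ C₀ * ((P.L : ℝ) ^ k * (|W ⟨y.shift ρ, μ⟩| + |W ⟨(y.shift ρ).unshift μ, μ⟩|)) * ((6 * ((P.L : ℝ) ^ k)⁻¹) * 2 ^ (P.d - 1)) := by
              gcongr
              exact hax _ _
          _ = 6 * 2 ^ (P.d - 1) * C₀ * (|W ⟨y.shift ρ, μ⟩| + |W ⟨(y.shift ρ).unshift μ, μ⟩|) * (((P.L : ℝ) ^ k)⁻¹ * (P.L : ℝ) ^ k) := by ring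
          _ = _ := by rw [hNinv, mul_one]
      have hb2 : |Z ⟨Site.fibreSite 0 k y r, μ⟩| ≤ 6 * 2 ^ (P.d - 1) * C₀ * (|W ⟨y, μ⟩| + |W ⟨y.unshift μ, μ⟩|) := by
        rw [e2, abs_mul, abs_mul, abs_of_nonneg hC0, abs_of_nonneg (mul_nonneg hψl0 hPρ0)]
        calc C₀ * |(((r μ : ℕ) : ℝ) + 1) * W ⟨y, μ⟩ + ((P.L ^ k - 1 - (r μ : ℕ) : ℕ) : ℝ) * W ⟨y.unshift μ, μ⟩|
              * (ψ (P.L ^ k - 1) * ∏ ν ∈ (univ.erase μ).erase ρ, ψ (r ν))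
            ≤ C₀ * ((P.L : ℝ) ^ k * (|W ⟨y, μ⟩| + |W ⟨y.unshift μ, μ⟩|)) * ((6 * ((P.L : ℝ) ^ k)⁻¹) * 2 ^ (P.d - 1)) := by
              gcongr
              exact hax _ _
          _ = 6 * 2 ^ (P.d - 1) * C₀ * (|W ⟨y, μ⟩| + |W ⟨y.unshift μ, μ⟩|) * (((P.L : ℝ) ^ k)⁻¹ * (P.L : ℝ) ^ k) := by ring
          _ = _ := by rw [hNinv, mul_one]
      calc |Z ⟨(Site.fibreSite 0 k y r).shift ρ, μ⟩ - Z ⟨Site.fibreSite 0 k y r, μ⟩|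
          ≤ |Z ⟨(Site.fibreSite 0 k y r).shift ρ, μ⟩| + |Z ⟨Site.fibreSite 0 k y r, μ⟩| := abs_sub _ _
        _ ≤ _ := by nlinarith [hb1, hb2, mul_nonneg hC0 h2pos, mul_nonneg (mul_nonneg hC0 h2pos) h3]

/-! ## §6 The gradient bounds at an arbitrary fine bond: pointwise (sup) and `ℓ²` -/

/-- **POINTWISE GRADIENT BOUND** at an arbitrary fine bond `b` (its initial point written in the block coordinates of `ȳ_b = B^k`-block of `b₋`).
[folklore] -/
theorem modField_shift_sub_abs_le_bond (b : PBond P 0) (ρ : Fin P.d) :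
    |Z ⟨b.src.shift ρ, b.dir⟩ - Z b|
      ≤ 6 * 2 ^ (P.d - 1) * (((P.L : ℝ) ^ k) ^ P.d * (P.L : ℝ) ^ k)⁻¹ *
        (|W ⟨Site.proj k k b.src, b.dir⟩| + |W ⟨(Site.proj k k b.src).unshift b.dir, b.dir⟩| + |W ⟨(Site.proj k k b.src).shift b.dir, b.dir⟩|
          + |W ⟨(Site.proj k k b.src).shift ρ, b.dir⟩| + |W ⟨((Site.proj k k b.src).shift ρ).unshift b.dir, b.dir⟩|) := by
  obtain ⟨r, hr⟩ := eq_fibreSite_proj h b.src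
  have := modField_shift_sub_abs_le h ψ W Z hZ hψ0 hψ2 hψL hψf hψl (Site.proj k k b.src) b.dir ρ r
  rw [← hr] at this
  exact this

/-- **SUP GRADIENT BOUND — THE SECOND HALF OF (46) FOR THE MODULATED TENT FIELD**: `|Z(b + e_ρ) − Z(b)| ≤ 30·2^{d−1}·(L^{kd}L^k)⁻¹·max|W|`, one order
`L^{−k}` below the sup bound `2^{d−1}(L^{kd})⁻¹max|W|` of `Z` itself. [cite: Balaban1985Variational, (46) p.285] -/
theorem modField_shift_sub_abs_le_of_bound {B : ℝ} (hW : ∀ c : PBond P k, |W c| ≤ B) (b : PBond P 0) (ρ : Fin P.d) :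
    |Z ⟨b.src.shift ρ, b.dir⟩ - Z b| ≤ 30 * 2 ^ (P.d - 1) * (((P.L : ℝ) ^ k) ^ P.d * (P.L : ℝ) ^ k)⁻¹ * B := by
  have h0 := modField_shift_sub_abs_le_bond h ψ W Z hZ hψ0 hψ2 hψL hψf hψl b ρ
  have hC : (0 : ℝ) ≤ 6 * 2 ^ (P.d - 1) * (((P.L : ℝ) ^ k) ^ P.d * (P.L : ℝ) ^ k)⁻¹ := by positivity
  have h5 : |W ⟨Site.proj k k b.src, b.dir⟩| + |W ⟨(Site.proj k k b.src).unshift b.dir, b.dir⟩| + |W ⟨(Site.proj k k b.src).shift b.dir, b.dir⟩|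
      + |W ⟨(Site.proj k k b.src).shift ρ, b.dir⟩| + |W ⟨((Site.proj k k b.src).shift ρ).unshift b.dir, b.dir⟩| ≤ 5 * B := by
    linarith [hW ⟨Site.proj k k b.src, b.dir⟩, hW ⟨(Site.proj k k b.src).unshift b.dir, b.dir⟩, hW ⟨(Site.proj k k b.src).shift b.dir, b.dir⟩,
      hW ⟨(Site.proj k k b.src).shift ρ, b.dir⟩, hW ⟨((Site.proj k k b.src).shift ρ).unshift b.dir, b.dir⟩]
  calc _ ≤ 6 * 2 ^ (P.d - 1) * (((P.L : ℝ) ^ k) ^ P.d * (P.L : ℝ) ^ k)⁻¹ * (5 * B) := h0.trans (mul_le_mul_of_nonneg_left h5 hC)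
    _ = _ := by ring

omit h hZ hψ0 hψ2 hψL hψf hψl in
/-- Five translated copies of `Σ_c W(c)²`. [folklore] -/
theorem sum_five_translates (ρ : Fin P.d) :
    ∑ μ : Fin P.d, ∑ y : Site P k, ((W ⟨y, μ⟩) ^ 2 + (W ⟨y.unshift μ, μ⟩) ^ 2 + (W ⟨y.shift μ, μ⟩) ^ 2 + (W ⟨y.shift ρ, μ⟩) ^ 2
        + (W ⟨(y.shift ρ).unshift μ, μ⟩) ^ 2) = 5 * ∑ c : PBond P k, (W c) ^ 2 := by
  have T1 : ∑ μ : Fin P.d, ∑ y : Site P k, (W ⟨y, μ⟩) ^ 2 = ∑ c : PBond P k, (W c) ^ 2 := sum_dir_site_eq (fun c => (W c) ^ 2)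
  have T2 : ∑ μ : Fin P.d, ∑ y : Site P k, (W ⟨y.unshift μ, μ⟩) ^ 2 = ∑ c : PBond P k, (W c) ^ 2 := by
    rw [sum_dir_site_eq (fun c => (W ⟨c.src.unshift c.dir, c.dir⟩) ^ 2), sum_pbond_unshift (fun c => (W c) ^ 2)]
  have T3 : ∑ μ : Fin P.d, ∑ y : Site P k, (W ⟨y.shift μ, μ⟩) ^ 2 = ∑ c : PBond P k, (W c) ^ 2 := by
    rw [← T1]; exact Finset.sum_congr rfl fun μ _ => sum_shift μ (fun y => (W ⟨y, μ⟩) ^ 2)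
  have T4 : ∑ μ : Fin P.d, ∑ y : Site P k, (W ⟨y.shift ρ, μ⟩) ^ 2 = ∑ c : PBond P k, (W c) ^ 2 := by
    rw [← T1]; exact Finset.sum_congr rfl fun μ _ => sum_shift ρ (fun y => (W ⟨y, μ⟩) ^ 2)
  have T5 : ∑ μ : Fin P.d, ∑ y : Site P k, (W ⟨(y.shift ρ).unshift μ, μ⟩) ^ 2 = ∑ c : PBond P k, (W c) ^ 2 := by
    rw [← T2]; exact Finset.sum_congr rfl fun μ _ => sum_shift ρ (fun y => (W ⟨y.unshift μ, μ⟩) ^ 2)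
  simp only [Finset.sum_add_distrib]
  rw [T1, T2, T3, T4, T5]; ring

/-- **`ℓ²` GRADIENT BOUND**: `Σ_b Σ_ρ (Z(b + e_ρ) − Z(b))² ≤ 900·d·4^{d−1}·(L^{kd}L^k)⁻²·L^{kd}·Σ_c W(c)²` — with `W = T⁻¹Z′` (`Σ W² ≤ 9L^{2kd}ΣZ′²`, part 3)
this is `O(L^{k(d−2)})·Σ_c Z′(c)²`, the Dirichlet-energy scale of a field that is smooth on the block scale. [folklore] -/
theorem modField_grad_sum_sq_le :
    ∑ b : PBond P 0, ∑ ρ : Fin P.d, (Z ⟨b.src.shift ρ, b.dir⟩ - Z b) ^ 2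
      ≤ 900 * P.d * 4 ^ (P.d - 1) * ((((P.L : ℝ) ^ k) ^ P.d * (P.L : ℝ) ^ k)⁻¹) ^ 2 * ((P.L : ℝ) ^ k) ^ P.d * ∑ c : PBond P k, (W c) ^ 2 := by
  set C₀ : ℝ := (((P.L : ℝ) ^ k) ^ P.d * (P.L : ℝ) ^ k)⁻¹ with hC₀
  have h4 : ((2 : ℝ) ^ (P.d - 1)) ^ 2 = 4 ^ (P.d - 1) := by rw [← pow_mul, mul_comm, pow_mul]; norm_num
  rw [Finset.sum_comm]
  have hρ : ∀ ρ : Fin P.d, ∑ b : PBond P 0, (Z ⟨b.src.shift ρ, b.dir⟩ - Z b) ^ 2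
      ≤ 900 * 4 ^ (P.d - 1) * C₀ ^ 2 * ((P.L : ℝ) ^ k) ^ P.d * ∑ c : PBond P k, (W c) ^ 2 := by
    intro ρ
    rw [sum_pbond_fine_eq h (fun b : PBond P 0 => (Z ⟨b.src.shift ρ, b.dir⟩ - Z b) ^ 2)]
    have hpt : ∀ (μ : Fin P.d) (y : Site P k) (r : Fin P.d → Fin (P.L ^ k)),
        (Z ⟨(Site.fibreSite 0 k y r).shift ρ, μ⟩ - Z ⟨Site.fibreSite 0 k y r, μ⟩) ^ 2
          ≤ 36 * 4 ^ (P.d - 1) * C₀ ^ 2 * (5 * ((W ⟨y, μ⟩) ^ 2 + (W ⟨y.unshift μ, μ⟩) ^ 2 + (W ⟨y.shift μ, μ⟩) ^ 2 + (W ⟨y.shift ρ, μ⟩) ^ 2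
            + (W ⟨(y.shift ρ).unshift μ, μ⟩) ^ 2)) := by
      intro μ y r
      have hb := modField_shift_sub_abs_le h ψ W Z hZ hψ0 hψ2 hψL hψf hψl y μ ρ r
      set S : ℝ := |W ⟨y, μ⟩| + |W ⟨y.unshift μ, μ⟩| + |W ⟨y.shift μ, μ⟩| + |W ⟨y.shift ρ, μ⟩| + |W ⟨(y.shift ρ).unshift μ, μ⟩| with hS
      have hS2 : S ^ 2 ≤ 5 * ((W ⟨y, μ⟩) ^ 2 + (W ⟨y.unshift μ, μ⟩) ^ 2 + (W ⟨y.shift μ, μ⟩) ^ 2 + (W ⟨y.shift ρ, μ⟩) ^ 2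
          + (W ⟨(y.shift ρ).unshift μ, μ⟩) ^ 2) := by
        rw [hS, ← sq_abs (W ⟨y, μ⟩), ← sq_abs (W ⟨y.unshift μ, μ⟩), ← sq_abs (W ⟨y.shift μ, μ⟩), ← sq_abs (W ⟨y.shift ρ, μ⟩),
          ← sq_abs (W ⟨(y.shift ρ).unshift μ, μ⟩)]
        nlinarith [sq_nonneg (|W ⟨y, μ⟩| - |W ⟨y.unshift μ, μ⟩|), sq_nonneg (|W ⟨y, μ⟩| - |W ⟨y.shift μ, μ⟩|),
          sq_nonneg (|W ⟨y, μ⟩| - |W ⟨y.shift ρ, μ⟩|), sq_nonneg (|W ⟨y, μ⟩| - |W ⟨(y.shift ρ).unshift μ, μ⟩|),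
          sq_nonneg (|W ⟨y.unshift μ, μ⟩| - |W ⟨y.shift μ, μ⟩|), sq_nonneg (|W ⟨y.unshift μ, μ⟩| - |W ⟨y.shift ρ, μ⟩|),
          sq_nonneg (|W ⟨y.unshift μ, μ⟩| - |W ⟨(y.shift ρ).unshift μ, μ⟩|), sq_nonneg (|W ⟨y.shift μ, μ⟩| - |W ⟨y.shift ρ, μ⟩|),
          sq_nonneg (|W ⟨y.shift μ, μ⟩| - |W ⟨(y.shift ρ).unshift μ, μ⟩|), sq_nonneg (|W ⟨y.shift ρ, μ⟩| - |W ⟨(y.shift ρ).unshift μ, μ⟩|)]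
      calc (Z ⟨(Site.fibreSite 0 k y r).shift ρ, μ⟩ - Z ⟨Site.fibreSite 0 k y r, μ⟩) ^ 2
          = |Z ⟨(Site.fibreSite 0 k y r).shift ρ, μ⟩ - Z ⟨Site.fibreSite 0 k y r, μ⟩| ^ 2 := (sq_abs _).symm
        _ ≤ (6 * 2 ^ (P.d - 1) * C₀ * S) ^ 2 := pow_le_pow_left₀ (abs_nonneg _) hb 2
        _ = 36 * 4 ^ (P.d - 1) * C₀ ^ 2 * S ^ 2 := by rw [← h4]; ring
        _ ≤ _ := mul_le_mul_of_nonneg_left hS2 (by positivity)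
    refine (Finset.sum_le_sum fun μ _ => Finset.sum_le_sum fun y _ => Finset.sum_le_sum fun r _ => hpt μ y r).trans ?_
    simp only [Finset.sum_const, Finset.card_univ, Fintype.card_fun, Fintype.card_fin, nsmul_eq_mul, Nat.cast_pow]
    simp only [← Finset.mul_sum]
    rw [sum_five_translates W ρ]
    ring_nf
    rfl
  calc ∑ ρ : Fin P.d, ∑ b : PBond P 0, (Z ⟨b.src.shift ρ, b.dir⟩ - Z b) ^ 2
      ≤ ∑ _ρ : Fin P.d, 900 * 4 ^ (P.d - 1) * C₀ ^ 2 * ((P.L : ℝ) ^ k) ^ P.d * ∑ c : PBond P k, (W c) ^ 2 := Finset.sum_le_sum fun ρ _ => hρ ρ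
    _ = _ := by rw [Finset.sum_const, Finset.card_univ, Fintype.card_fin, nsmul_eq_mul]; ring

end Bounds

end Summit.QuantumFields.YangMills.Theorems.Prop7LineAvgSmoothRightInverse

end
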